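import Summits.Ventures.HodgeKum4.FixedLocus
import Literature.AlgebraicGeometry.Hyperkaehler.GeneralizedKummerTypeTranslationGroup
import HarnessLib

/-!
# The route's print inputs F_Γ, F_Γ′ close from the Literature named facts (cell `hodge-kum4`, seat p2)

HONEST FRAMING.  Nothing is asserted unconditionally: this file PROVES that the Statement's support
items `Kum4TranslationGroup` (F_Γ) and `Kum4TranslationGroupTrivialOffMiddle` (F_Γ′) follow from the
Literature named facts `Floccari2026_card_autFixingH2H3_kum4Type` and
`Foster2024_translationAction_kum4Type` (`Hyperkaehler/GeneralizedKummerTypeTranslationGroup`), by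
unfolding: the Statement's `Γ(X) = Summit.Ventures.HodgeKum4.autFixingH2H3 X` and the Literature
`Literature.AlgebraicGeometry.Hyperkaehler.autFixingH2H3 X` are the same subgroup (`rfl`), and
`middleRep X` is `translationRep X 8` (`rfl`).
-/

noncomputable section

open CategoryTheory
open Literature.AlgebraicGeometry Literature.AlgebraicGeometry.HodgeTheory

namespace Summit.Ventures.HodgeKum4

/-- The Statement's `Γ(X)` IS the Literature `Γ(X)` (same definition). -/
theorem autFixingH2H3_eq_literature (X : Motives.SchemeOver ℂ) :
    autFixingH2H3 X = Literature.AlgebraicGeometry.Hyperkaehler.autFixingH2H3 X :=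
  rfl

/-- The Statement's `middleRep X` IS the Literature `translationRep X 8` (same definition). -/
theorem middleRep_eq_translationRep (X : Motives.SchemeOver ℂ) :
    middleRep X = Literature.AlgebraicGeometry.Hyperkaehler.translationRep X 8 :=
  rfl

/-- **F_Γ from print**: `Kum4TranslationGroup` (`|Γ(X)| = 625 ∧ dim 𝒦 ≤ 624`) follows from the
Literature facts `Floccari2026_card_autFixingH2H3_kum4Type` and `Foster2024_translationAction_kum4Type`. -/
theorem kum4TranslationGroup_of_literature
    (h₁ : Literature.AlgebraicGeometry.Hyperkaehler.Floccari2026_card_autFixingH2H3_kum4Type)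
    (h₂ : Literature.AlgebraicGeometry.Hyperkaehler.Foster2024_translationAction_kum4Type) :
    Summit.Ventures.HodgeKum4.Kum4TranslationGroup :=
  fun _ hX hK ↦ ⟨h₁ hX hK, (h₂ hX hK).1⟩

/-- **F_Γ′ from print**: `Kum4TranslationGroupTrivialOffMiddle` (`Γ(X)` trivial on `Hᵏ`, `k ≠ 8`)
follows from the Literature fact `Foster2024_translationAction_kum4Type` (clause (ii)). -/
theorem kum4TranslationGroupTrivialOffMiddle_of_literature
    (h₂ : Literature.AlgebraicGeometry.Hyperkaehler.Foster2024_translationAction_kum4Type) :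
    Summit.Ventures.HodgeKum4.Kum4TranslationGroupTrivialOffMiddle :=
  fun _ hX hK k hk g hg ↦ (h₂ hX hK).2.2 k hk g hg

/-- **L3a from print**: `Γ(X)` is finite. -/
theorem gammaFinite_of_literature
    (h₁ : Literature.AlgebraicGeometry.Hyperkaehler.Floccari2026_card_autFixingH2H3_kum4Type) :
    Summit.Ventures.HodgeKum4.GammaFiniteKum4 :=
  fun X hX hK ↦ by
    have h : Nat.card (autFixingH2H3 X) = 625 := h₁ hX hK
    exact Nat.finite_of_card_ne_zero (by rw [h]; norm_num)

end Summit.Ventures.HodgeKum4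

end
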